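import Mathlib.CategoryTheory.Pi.Basic
import Mathlib.CategoryTheory.Limits.Preserves.Finite
import Mathlib.CategoryTheory.Limits.Shapes.Terminal
import Mathlib.CategoryTheory.Countable
import Mathlib.CategoryTheory.EssentialImage
import Mathlib.CategoryTheory.ConnectedComponents
import Literature.AnabelianGeometry.SemiGraphs.Temperoids
import Literature.AlgebraicGeometry.Frobenioids.QuasiTemperoid
import HarnessLib

/-!
# Semi-graphs of anabelioids, Appendix: quasi-temperoids (part 1: Definition A.1, Remarks
# A.1.1–A.1.2, Proposition A.2)

Mochizuki, *Semi-graphs of anabelioids*, Publ. RIMS **42** (2006) 221–322, Appendix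
"Quasi-temperoids", author's manuscript pp. 79–81 [cite: MochizukiSemiAnbd2006, Appendix pp.79-81]:
"a certain minor generalization of the notion of a temperoid introduced in §3" — the categories
`T[A]` (§0 p. 6: the full subcategory of objects admitting a morphism to `A`; the tree's `Over' A`)
for `A` a connected object of a connected temperoid `T`, their countable products, and the
(quasi-)morphisms between them.

* Definition A.1 (i): *connected quasi-temperoids*. ONE notion in the tree: the predicate is
  `Literature.AlgebraicGeometry.Frobenioids.QuasiTemperoid.IsConnectedQuasiTemperoid` (typed from
  the recall [FrdII] Ex. 1.3 (i), "`B^temp(Π, Π°)`" form); here the printed `T[A]`-form is the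
  chart `ConnectedQuasiTemperoidChart` (a presentation, data) and the two forms are proved
  equivalent in the proof-only companion `QuasiTemperoidsCharts.lean`
  (`isConnectedQuasiTemperoid_iff_nonempty_chart`: `B^temp(Π, Π°) = T[Π/Π°]`, and every connected
  object of `B^temp(Π)` is a coset object `Π/Stab(x)`, Rmk. 3.1.2), so no second predicate is
  introduced;
* Definition A.1 (ii): *quasi-temperoids* (`QuasiTemperoidChart`, `IsQuasiTemperoid`) and
  *nondegenerate* objects (`IsNondegenerateObj`);
* Definition A.1 (iii): *quasi-morphisms* `φ : Q₁ → Q₂` = functors `φ^* : Q₂ ⥤ Q₁` preserving finite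
  limits and countable colimits — literally the data of Def. 3.1 (iii), so the tree's `TemperoidHom`
  is reused (`QuasiHom`); *rigid* = `TemperoidHom.IsRigid`; *morphisms* = quasi-morphisms whose
  functor preserves nondegenerate objects (`TemperoidHom.PreservesNondegenerate`);
* Remark A.1.1 (`QuasiTemperoidAlmostTotallyEpimorphic`) and Remark A.1.2 (`ConnectedQuasiTemperoidNoTerminal`,
  `ConstEmptyIsQuasiHomNotMorphism`) as named facts;
* Proposition A.2 (i)–(v) (connected components of quasi-temperoids) as named facts over a
  countable family `Q : E → (categories)` of connected quasi-temperoids and Mathlib's product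
  category `∀ e, Q e` (`CategoryTheory.Pi`): the projections `π_e^* = Pi.eval`, the inclusion
  functors `ι_e` (characterised by their defining property `IsInclusionFunctor`, "identity"
  rendered as "isomorphic to the identity"), `Q_ε` = the objects concentrated at `e`.

Remark A.2.1 ("Proposition A.2 serves, in effect, to reduce the theory of arbitrary
quasi-temperoids to the theory of connected quasi-temperoids") is expository, not typed.
Definition A.3, Remark A.3.1, Theorem A.4, Remarks A.4.1–A.4.2 (QD-pairs and the reconstruction of
`T` from `T[A]`) are the sequel `QuasiTemperoidsQDPairs.lean`. No statement of the paper is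
strengthened; typed ≠ discharged.
-/

open CategoryTheory CategoryTheory.Limits Topology

namespace Literature.AnabelianGeometry.SemiGraphs

open Literature.AlgebraicGeometry.Frobenioids (IsRigidFunctor IsConnectedObj IsNonemptyObj
  IsAlmostTotallyEpimorphic IsOfCountablyConnectedType)
open Literature.AlgebraicGeometry.Frobenioids.QuasiTemperoid (IsConnectedQuasiTemperoid BTempRel
  cosetObj)

universe w v₁ v₂ u u₁ u₂

/-! ### Definition A.1 (i): connected quasi-temperoids, `T[A]`-form -/

section ConnectedQuasiTemperoids

variable (Q : Type u₁) [Category.{v₁} Q]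

/-- A presentation of `Q` as a connected quasi-temperoid in the printed form of **Definition A.1
(i)** (SemiAnbd Appendix p. 79): "Any category equivalent to a category of the form `T[A]` — where
`A` is a connected object, and `T` is a connected temperoid — will be referred to as a *connected
quasi-temperoid*." Here `T = B^temp(Π)` for a tempered group `Π` (every connected temperoid is
equivalent to such a `T`, Def. 3.1 (ii), and `T[A]` is transported along equivalences), `A` is a
connected object of `T` and `T[A] = Over' A` (§0 p. 6). That these charts present exactly the
connected quasi-temperoids of the tree's predicate `IsConnectedQuasiTemperoid` ([FrdII] Ex. 1.3 (i)
form) is `isConnectedQuasiTemperoid_iff_nonempty_chart` (companion `QuasiTemperoidsCharts.lean`).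
[cite: MochizukiSemiAnbd2006, Def A.1(i) p.79] -/
structure ConnectedQuasiTemperoidChart : Type (max u₁ v₁ (u + 1)) where
  /-- the tempered group `Π` -/
  G : Type u
  /-- its group structure -/
  [group : Group G]
  /-- its topology -/
  [topologicalSpace : TopologicalSpace G]
  /-- it is a topological group -/
  [isTopologicalGroup : IsTopologicalGroup G]
  /-- `Π` is tempered -/
  isTempered : IsTempered G
  /-- the connected object `A` of `T = B^temp(Π)` -/
  A : BTemp G
  /-- `A` is connected -/
  isConnectedObj : IsConnectedObj A
  /-- `Q ≌ T[A]` -/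
  equiv : Q ≌ Over' A

attribute [instance] ConnectedQuasiTemperoidChart.group ConnectedQuasiTemperoidChart.topologicalSpace
  ConnectedQuasiTemperoidChart.isTopologicalGroup

variable {Q}

/-- `C[A]` is closed under isomorphisms (precompose with the inverse). [cite: MochizukiSemiAnbd2006, §0 p.6] -/
instance admitsHomTo_isClosedUnderIsomorphisms {C : Type u₂} [Category.{v₂} C] (A : C) :
    (admitsHomTo A).IsClosedUnderIsomorphisms :=
  ⟨fun e ⟨f⟩ => ⟨e.inv ≫ f⟩⟩

/-- `C[A] ≌ C[A']` for `A ≅ A'`: the same full subcategory of `C` (Mathlib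
`ObjectProperty.fullSubcategoryCongr`). [cite: MochizukiSemiAnbd2006, §0 p.6] -/
def overPrimeCongr {C : Type u₂} [Category.{v₂} C] {A A' : C} (i : A ≅ A') : Over' A ≌ Over' A' :=
  ObjectProperty.fullSubcategoryCongr (funext fun _ =>
    propext ⟨fun ⟨f⟩ => ⟨f ≫ i.hom⟩, fun ⟨f⟩ => ⟨f ≫ i.inv⟩⟩)

/-- `C[A]` is transported along an equivalence `e : C ≌ D`: `C[A] ≌ D[e A]` (so Definition A.1 (i)
for a general connected temperoid `T ≌ B^temp(Π)` reduces to the charts above).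
[cite: MochizukiSemiAnbd2006, §0 p.6] -/
noncomputable def overPrimeEquivOfEquiv {C : Type u₂} [Category.{v₂} C] {D : Type u₁}
    [Category.{v₁} D] (e : C ≌ D) (A : C) : Over' A ≌ Over' (e.functor.obj A) :=
  e.congrFullSubcategory (Q := admitsHomTo (e.functor.obj A)) (P := admitsHomTo A) (by
    funext X
    apply propext
    change Nonempty (e.functor.obj X ⟶ e.functor.obj A) ↔ Nonempty (X ⟶ A)
    exact ⟨fun ⟨f⟩ => ⟨e.functor.preimage f⟩, fun ⟨f⟩ => ⟨e.functor.map f⟩⟩)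

/-- `B^temp(Π, Π°)` ([FrdII] Ex. 1.3 (i), the tree's `BTempRel`) IS `T[A]` for `T = B^temp(Π)` and
`A = Π/Π°` (`cosetObj`): the two full subcategories of `B^temp(Π)` have the same objects.
[cite: MochizukiSemiAnbd2006, Def A.1(i) p.79] -/
def bTempRelEquivOverPrime (G : Type u) [Group G] [TopologicalSpace G] [IsTopologicalGroup G]
    (hG : IsTempered G) (H : Subgroup G) (hH : IsOpen (H : Set G)) :
    BTempRel G H ≌ Over' (cosetObj G hG H hH) :=
  ObjectProperty.fullSubcategoryCongr (funext fun _ =>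
    propext ⟨fun ⟨f⟩ => ⟨ObjectProperty.homMk f⟩, fun ⟨f⟩ => ⟨f.hom⟩⟩)

end ConnectedQuasiTemperoids

/-! ### Definition A.1 (ii): quasi-temperoids, nondegenerate objects -/

section QuasiTemperoids

variable (Q : Type u₁) [Category.{v₁} Q]

/-- A presentation of `Q` as a quasi-temperoid (**Definition A.1 (ii)**, SemiAnbd Appendix p. 79):
a countable [possibly empty] family of connected quasi-temperoids `B^temp(Πᵢ)[Aᵢ]` and an
equivalence of `Q` with their product `∏ᵢ B^temp(Πᵢ)[Aᵢ]` [a product of categories].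
[cite: MochizukiSemiAnbd2006, Def A.1(ii) p.79] -/
structure QuasiTemperoidChart : Type (max u₁ v₁ (u + 1)) where
  /-- the [countable, possibly empty] index set -/
  ι : Type
  /-- it is countable -/
  countable : Countable ι
  /-- the tempered groups -/
  G : ι → Type u
  /-- their group structures -/
  [group : ∀ i, Group (G i)]
  /-- their topologies -/
  [topologicalSpace : ∀ i, TopologicalSpace (G i)]
  /-- they are topological groups -/
  [isTopologicalGroup : ∀ i, IsTopologicalGroup (G i)]
  /-- they are tempered -/
  isTempered : ∀ i, IsTempered (G i)
  /-- the connected objects `Aᵢ ∈ B^temp(Πᵢ)` -/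
  A : ∀ i, BTemp (G i)
  /-- they are connected -/
  isConnectedObj : ∀ i, IsConnectedObj (A i)
  /-- `Q ≌ ∏ᵢ B^temp(Πᵢ)[Aᵢ]` -/
  equiv : Q ≌ (∀ i, Over' (A i))

attribute [instance] QuasiTemperoidChart.group QuasiTemperoidChart.topologicalSpace
  QuasiTemperoidChart.isTopologicalGroup

/-- **Definition A.1 (ii)** (SemiAnbd Appendix p. 79): "A category equivalent to a product [in the
sense of a product of categories] of a countable [hence possibly empty!] collection of connected
quasi-temperoids will be referred to as a *quasi-temperoid*."
[cite: MochizukiSemiAnbd2006, Def A.1(ii) p.79] -/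
def IsQuasiTemperoid : Prop := Nonempty (QuasiTemperoidChart.{v₁, u, u₁} Q)

/-- `(∏_{* ∈ {*}} C) ≌ C`, the product of a one-member family of categories (so that a connected
quasi-temperoid is a quasi-temperoid, `IsQuasiTemperoid.of_chart` in the companion). [folklore] -/
def piPUnitEquivalence (C : Type u₁) [Category.{v₁} C] : (∀ _ : PUnit.{1}, C) ≌ C where
  functor := Pi.eval _ PUnit.unit
  inverse := Functor.pi' fun _ => 𝟭 C
  unitIso := Iso.refl _
  counitIso := Iso.refl _
  functor_unitIso_comp X := by
    change 𝟙 (X PUnit.unit) ≫ 𝟙 (X PUnit.unit) = 𝟙 (X PUnit.unit)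
    exact Category.comp_id _

variable {Q}

/-- **Definition A.1 (ii)** (SemiAnbd Appendix p. 79): "An object `A` of a quasi-temperoid `Q` will
be called *nondegenerate* if, for every connected object `B` of `Q`, there exist arrows `C → B`,
`C → A`, for some connected object `C` of `Q`." (Stated in any category; "connected" is the §0
notion `IsConnectedObj`.) [cite: MochizukiSemiAnbd2006, Def A.1(ii) p.79] -/
def IsNondegenerateObj (A : Q) : Prop :=
  ∀ B : Q, IsConnectedObj B → ∃ C : Q, IsConnectedObj C ∧ Nonempty (C ⟶ B) ∧ Nonempty (C ⟶ A)

end QuasiTemperoids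

/-! ### Definition A.1 (iii): quasi-morphisms, rigid quasi-morphisms, morphisms -/

section QuasiHoms

variable (Q₁ : Type u₁) [Category.{v₁} Q₁] (Q₂ : Type u₂) [Category.{v₂} Q₂]

/-- **Definition A.1 (iii)** (SemiAnbd Appendix p. 79): "Let `Q₁`, `Q₂` be quasi-temperoids. Then a
*quasi-morphism* `φ : Q₁ → Q₂` is defined to be a functor `φ^* : Q₂ → Q₁` that preserves finite
limits and countable colimits" — the same data as a morphism of temperoids (Def. 3.1 (iii)), so
the tree's `TemperoidHom` is reused. "A quasi-morphism `φ` will be called *rigid* … if the functor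
`φ^*` is rigid [cf. §0]" is `TemperoidHom.IsRigid`. [cite: MochizukiSemiAnbd2006, Def A.1(iii) p.79] -/
abbrev QuasiHom : Type (max u₁ u₂ v₁ v₂) := TemperoidHom Q₁ Q₂

variable {Q₁ Q₂}

/-- **Definition A.1 (iii)** (SemiAnbd Appendix p. 79): "A quasi-morphism `φ` will be called … a
*morphism* if the functor `φ^*` … preserves nondegenerate objects."
[cite: MochizukiSemiAnbd2006, Def A.1(iii) p.79] -/
def TemperoidHom.PreservesNondegenerate (φ : TemperoidHom Q₁ Q₂) : Prop :=
  ∀ A : Q₂, IsNondegenerateObj A → IsNondegenerateObj (φ.pullback.obj A)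

end QuasiHoms

/-! ### Remarks A.1.1 and A.1.2 -/

section Remarks

/-- **Remark A.1.1** (SemiAnbd Appendix p. 79), named fact: "One verifies immediately that a
quasi-temperoid is an almost totally epimorphic category of countably connected type [cf. §0]."
[cite: MochizukiSemiAnbd2006, Rmk A.1.1 p.79] -/
def QuasiTemperoidAlmostTotallyEpimorphic : Prop :=
  ∀ (Q : Type u₁) [Category.{v₁} Q], IsQuasiTemperoid.{v₁, u, u₁} Q →
    IsAlmostTotallyEpimorphic Q ∧ IsOfCountablyConnectedType Q

/-- **Remark A.1.2**, first sentence (SemiAnbd Appendix p. 80), named fact: "Unlike the situation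
with temperoids, a quasi-temperoid does not, in general, admit a terminal object" — there is a
tempered group `Π` and a connected `A ∈ B^temp(Π)` such that `B^temp(Π)[A]` has no terminal object
(e.g. `Π = ℤ` discrete acting on `A = ℤ`). [cite: MochizukiSemiAnbd2006, Rmk A.1.2 p.80] -/
def ConnectedQuasiTemperoidNoTerminal : Prop :=
  ∃ (G : Type u) (_ : Group G) (_ : TopologicalSpace G) (_ : IsTopologicalGroup G) (A : BTemp G),
    IsTempered G ∧ IsConnectedObj A ∧ ¬ HasTerminal (Over' A)

/-- **Remark A.1.2**, second part (SemiAnbd Appendix p. 80), named fact: "Thus, it is not in general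
the case that a quasi-morphism of quasi-temperoids is necessarily a morphism. Indeed, if `Q` is a
connected quasi-temperoid that does not admit a terminal object, then one verifies immediately that
the functor `Q → Q` that maps all objects of `Q` to some empty [initial] object of `Q` preserves
finite limits and countable colimits, but fails to preserve nondegenerate objects."
[cite: MochizukiSemiAnbd2006, Rmk A.1.2 p.80] -/
def ConstEmptyIsQuasiHomNotMorphism : Prop :=
  ∀ (Q : Type u₁) [Category.{v₁} Q], IsConnectedQuasiTemperoid.{v₁, u₁, u} Q → ¬ HasTerminal Q →
    ∀ (E : Q), IsInitial E →
      PreservesFiniteLimits ((Functor.const Q).obj E) ∧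
      (∀ (J : Type) [SmallCategory J] [CountableCategory J],
        PreservesColimitsOfShape J ((Functor.const Q).obj E)) ∧
      ¬ ∀ A : Q, IsNondegenerateObj A → IsNondegenerateObj (((Functor.const Q).obj E).obj A)

end Remarks

/-! ### Proposition A.2: connected components of quasi-temperoids -/

section PropA2

variable {E : Type} (Q : E → Type u₁) [∀ e, Category.{v₁} (Q e)]

/-- The *inclusion functor* `ι_e : Q_e → Q = ∏ Q_f` of **Proposition A.2 (ii)** (SemiAnbd Appendix
p. 80): "the functor whose composite with `π_f^*`, where `f ∈ E`, maps all objects of `Q_e` to empty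
[i.e., initial] objects of `Q_f` if `f ≠ e`, and is the identity if `f = e`" — recorded as the
defining property of a functor `ι` ("is the identity" rendered "is isomorphic to the identity").
[cite: MochizukiSemiAnbd2006, Prop A.2(ii) p.80] -/
structure IsInclusionFunctor (e : E) (ι : Q e ⥤ ∀ f, Q f) : Prop where
  /-- `π_e^* ∘ ι_e` is [isomorphic to] the identity -/
  self : Nonempty (ι ⋙ Pi.eval Q e ≅ 𝟭 (Q e))
  /-- `π_f^* ∘ ι_e` maps every object to an initial object for `f ≠ e` -/
  other : ∀ f, f ≠ e → ∀ X : Q e, Nonempty (IsInitial ((ι.obj X) f))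

/-- An object `A = (A_f)_f` of `Q = ∏ Q_f` is *concentrated at `e`* if `A_f` is empty [initial] for
every `f ≠ e`; for `ε` the connected component of `Q⁰` corresponding to `e` these are the objects
of "`Q_ε ⊆ Q`, the full subcategory determined by the objects `A` of `Q` such that all of the
connected components of `A` belong to `ε`" (Prop. A.2 (ii), p. 80).
[cite: MochizukiSemiAnbd2006, Prop A.2(ii) p.80] -/
def IsConcentratedAt (e : E) (A : ∀ f, Q f) : Prop := ∀ f, f ≠ e → Nonempty (IsInitial (A f))

/-- **Proposition A.2 (i)** (SemiAnbd Appendix p. 80), named fact: for a countable family of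
connected quasi-temperoids `Q_e` and `Q := ∏_{e ∈ E} Q_e`, "for each `e ∈ E`, the natural projection
functor `π_e^* : Q → Q_e` determines a morphism of quasi-temperoids `Q_e → Q`" — `Pi.eval Q e`
preserves finite limits, countable colimits and nondegenerate objects.
[cite: MochizukiSemiAnbd2006, Prop A.2(i) p.80] -/
def PropA2i : Prop :=
  ∀ {E : Type} [Countable E] (Q : E → Type u₁) [∀ e, Category.{v₁} (Q e)],
    (∀ e, IsConnectedQuasiTemperoid.{v₁, u₁, u} (Q e)) → ∀ e : E,
      ∃ π : TemperoidHom (Q e) (∀ f, Q f), π.pullback = Pi.eval Q e ∧ π.PreservesNondegenerate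

/-- **Proposition A.2 (ii)** (SemiAnbd Appendix p. 80), named fact: with `ι_e : Q_e → Q` the
inclusion functor and, for `ε` a connected component of the full subcategory of connected objects
`Q⁰ ⊆ Q`, `Q_ε ⊆ Q` the full subcategory of objects all of whose connected components belong to `ε`:
"the essential image of `ι_e` is equal to `Q_ε` for a unique `ε`, and, moreover, the resulting
correspondence `e ↦ ε` determines a bijection between `E` and the set of connected components of
`Q⁰`" — typed as: inclusion functors exist at every `e`; the essential image of any inclusion functor
at `e` is the subcategory of objects concentrated at `e`; and `e ↦` (the component of `Q⁰`
containing the connected objects concentrated at `e`) is a well-defined bijection `E ≃ π₀(Q⁰)`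
(Mathlib `ConnectedComponents` of the tree's `ConnectedPart`).
[cite: MochizukiSemiAnbd2006, Prop A.2(ii) p.80] -/
def PropA2ii : Prop :=
  ∀ {E : Type} [Countable E] (Q : E → Type u₁) [∀ e, Category.{v₁} (Q e)],
    (∀ e, IsConnectedQuasiTemperoid.{v₁, u₁, u} (Q e)) →
    (∀ e : E, ∃ ι : Q e ⥤ ∀ f, Q f, IsInclusionFunctor Q e ι) ∧
    (∀ (e : E) (ι : Q e ⥤ ∀ f, Q f), IsInclusionFunctor Q e ι →
      ∀ A : ∀ f, Q f, ι.essImage A ↔ IsConcentratedAt Q e A) ∧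
    ∃ β : E ≃ ConnectedComponents (Literature.AlgebraicGeometry.Frobenioids.ConnectedPart (∀ f, Q f)),
      ∀ (e : E) (X : Literature.AlgebraicGeometry.Frobenioids.ConnectedPart (∀ f, Q f)),
        β e = Quotient.mk (Zigzag.setoid _) X ↔ IsConcentratedAt Q e X.obj

/-- **Proposition A.2 (iii)** (SemiAnbd Appendix p. 80), named fact: "The nondegenerate objects of
`Q` are precisely the objects each of whose component objects `∈ Ob(Q_e)` is nonempty."
[cite: MochizukiSemiAnbd2006, Prop A.2(iii) p.80] -/
def PropA2iii : Prop :=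
  ∀ {E : Type} [Countable E] (Q : E → Type u₁) [∀ e, Category.{v₁} (Q e)],
    (∀ e, IsConnectedQuasiTemperoid.{v₁, u₁, u} (Q e)) →
    ∀ A : ∀ f, Q f, IsNondegenerateObj A ↔ ∀ e, IsNonemptyObj (A e)

/-- **Proposition A.2 (iv)** (SemiAnbd Appendix p. 80), named fact: "If `φ` is a morphism of
quasi-temperoids, and both `E` and `E′` are of cardinality one, then the functor `φ^*` is faithful"
— i.e. for connected quasi-temperoids `Q₁`, `Q₂` and a morphism `φ : Q₁ → Q₂`, `φ^*` is faithful.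
[cite: MochizukiSemiAnbd2006, Prop A.2(iv) p.80] -/
def PropA2iv : Prop :=
  ∀ (Q₁ : Type u₁) [Category.{v₁} Q₁] (Q₂ : Type u₂) [Category.{v₂} Q₂],
    IsConnectedQuasiTemperoid.{v₁, u₁, u} Q₁ → IsConnectedQuasiTemperoid.{v₂, u₂, u} Q₂ →
    ∀ φ : TemperoidHom Q₁ Q₂, φ.PreservesNondegenerate → φ.pullback.Faithful

/-- **Proposition A.2 (v)** (SemiAnbd Appendix pp. 80–81), named fact: "If `φ` is a morphism of
quasi-temperoids, then `φ` induces a map `ψ : E → E′`, and, for each `e ∈ E`, a morphism of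
quasi-temperoids `φ_e : Q_e → Q′_{ψ(e)}` such that `φ` coincides with the morphism of quasi-temperoids
formed by 'taking the product' [in the evident sense] of the `φ_e`" — `φ^* ≅ (A′ ↦ (φ_e^* A′_{ψ e})_e)`.
[cite: MochizukiSemiAnbd2006, Prop A.2(v) pp.80-81] -/
def PropA2v : Prop :=
  ∀ {E : Type} [Countable E] (Q : E → Type u₁) [∀ e, Category.{v₁} (Q e)]
    {E' : Type} [Countable E'] (Q' : E' → Type u₂) [∀ e', Category.{v₂} (Q' e')],
    (∀ e, IsConnectedQuasiTemperoid.{v₁, u₁, u} (Q e)) →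
    (∀ e', IsConnectedQuasiTemperoid.{v₂, u₂, u} (Q' e')) →
    ∀ φ : TemperoidHom (∀ e, Q e) (∀ e', Q' e'), φ.PreservesNondegenerate →
      ∃ (ψ : E → E') (φe : ∀ e, TemperoidHom (Q e) (Q' (ψ e))),
        (∀ e, (φe e).PreservesNondegenerate) ∧
        Nonempty (φ.pullback ≅ Functor.pi' fun e => Pi.eval Q' (ψ e) ⋙ (φe e).pullback)

end PropA2

end Literature.AnabelianGeometry.SemiGraphs
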